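import Mathlib
import Summits.ValiantsHypothesis.ValiantsHypothesis.Theorems.DivisionGapZeroOneTransferMmBlockFloor
import Summits.ValiantsHypothesis.ValiantsHypothesis.Theorems.DivisionGapZeroOneTransferTriPMPowLowerBound
import Summits.ValiantsHypothesis.ValiantsHypothesis.Theorems.DivisionGapZeroOneTransferProjClosureAux

/-!
# Crux `DivisionGap.ZeroOneTransfer` (stmt-ValiantsHypothesis-5066), line `charged-uncharged`, Part D-III
(lead c12): `X = D_n^M · Y` with `Y` sparse somewhere is not an uncharged certificate — D-I and D-II unified

Part D-I (`mm_certificate_blockFloor`, p158446) excludes uncharged certificates `X` for `D_n = triPM n` having a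
monomial that misses an aligned polylog-block; Part D-II (`triPM_pow_lower_bound`, p158570) excludes the powers
`X = D_n^M`.  This file excludes their products: `X = D_n^M · Y` whenever ONE monomial of `Y` misses ONE aligned
block — the first certificate shape that neither named theorem covered.

* `complexity_le_of_mul_unit` — over `ℝ≥0`, a homogeneous `P` costs at most one gate more than `P · Y`
  whenever `Y(0) ≠ 0`: the lowest-degree component of `P · Y` is `Y(0) · P` and bottom components are free
  (`ProjClosure.complexity_botComponent_le`, p89287's part 1).
* `triPM_pow_mul_blockFloor` — for even `n`, even `m ≥ 64`, `M ≥ 1`, `24 L + 60 ≤ m` and `Y` with a monomial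
  meeting fewer than `(n/m)²` first vertices: `T^L ≤ (L₊(D_n^M · Y) + 1) · (T-1)^L`.  The block restriction of
  D-I maps `D_n^M · Y` to `c^M · D_m^M · Y'` with `Y'(0) ≠ 0`, and D-II bounds `L₊(D_m^M)`.
* `not_mm_certificate_pow_mul_sparse` — asymptotically: no constant `c` admits, for every `n`, `M` and `Y` with
  a monomial of fewer than `n² / 2^((log₂ n + c)^c)` variables and `L₊(D_n^{M+1} · Y) ≤ 2^((log₂ n + c)^c)`
  (contains `not_mm_certificate_with_sparse_monomial` as `M = 0` and `not_mm_certificate_pow` as `Y = 1`).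
[cite: Valiant1980, §3 Thm 1]
-/

noncomputable section

-- `Summit.ValiantsHypothesis.ValiantsHypothesis.…` is the tree's mandated single-conjunct layout
-- (Sub = Summit), so the duplicated namespace component is intended.
set_option linter.dupNamespace false

namespace Summit.ValiantsHypothesis.ValiantsHypothesis.Theorems.DivisionGapZeroOneTransfer

open MvPolynomial
open Literature.Computability.AlgebraicComplexity
open Summit.ValiantsHypothesis.ValiantsHypothesis.Theorems.TriangularDimersDivisionEasy.Negative
open scoped NNReal BigOperators

namespace TriPMPowMul

variable {n : ℕ}

/-- **A unit-constant cofactor cannot make a homogeneous polynomial cheaper (up to one gate).**  Over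
`ℝ≥0`, if `P` is homogeneous and `Y(0) ≠ 0` then `L₊(P) ≤ L₊(P · Y) + 1`: the bottom component (for the
total-degree weight) of `P · Y` is `P · Y(0)`, bottom components are free, and unscaling costs one gate.
[folklore] -/
theorem complexity_le_of_mul_unit {σ : Type*} {P Y : MvPolynomial σ ℝ≥0} {d : ℕ}
    (hP : P.IsHomogeneous d) (hY : coeff 0 Y ≠ 0) :
    complexity P ≤ complexity (P * Y) + 1 := by
  classical
  set w : σ → ℕ := (1 : σ → ℕ) with hw
  -- bottom component of `Y` is its constant term
  have hbdeg : ProjClosure.botDegree w Y = 0 := by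
    have := ProjClosure.botDegree_le w (p := Y) (d := 0) (mem_support_iff.2 hY)
    simpa using this
  have hbY : ProjClosure.botComponent w Y = C (coeff 0 Y) := by
    unfold ProjClosure.botComponent
    rw [hbdeg]
    exact homogeneousComponent_zero Y
  have hbP : ProjClosure.botComponent w P = P :=
    ProjClosure.botComponent_eq_self_of_isWeightedHomogeneous w hP
  have hbot : ProjClosure.botComponent w (P * Y) = coeff 0 Y • P := by
    rw [ProjClosure.botComponent_mul, hbP, hbY, smul_eq_C_mul, mul_comm]
  have h1 : complexity (coeff 0 Y • P) ≤ complexity (P * Y) := by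
    rw [← hbot]; exact ProjClosure.complexity_botComponent_le w _
  have h2 : complexity P ≤ complexity (coeff 0 Y • P) + 1 := by
    have hP' : P = (coeff 0 Y)⁻¹ • (coeff 0 Y • P) := by
      rw [smul_smul, inv_mul_cancel₀ hY, one_smul]
    conv_lhs => rw [hP']
    exact complexity_smul_le_holds _ _
  omega

/-- **Block restriction of `D_n^M · Y`.**  For even `n`, even `m ≥ 64`, `M ≥ 1`, an aligned block
`[p m, p m + m) × [q m, q m + m)` inside the rhombus, `24 L + 60 ≤ m`, and `Y` with a monomial none of whose
variables has its first vertex in the block: `T^L ≤ (L₊(D_n^M · Y) + 1) · (T-1)^L`. [cite: Valiant1980, §3 Thm 1] -/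
theorem pow_mul_of_avoids_block {m p q M : ℕ} (hn : Even n) (h64 : 64 ≤ m) (hme : Even m) (hM : 1 ≤ M)
    (hpm : p * m + m ≤ n) (hqm : q * m + m ≤ n)
    (Y : MvPolynomial ((Fin n × Fin n) × (Fin n × Fin n)) ℝ≥0)
    (hY : ∃ μ ∈ Y.support, ∀ e ∈ μ.support,
      ¬ ((p * m ≤ (e.1.1 : ℕ) ∧ (e.1.1 : ℕ) < p * m + m) ∧ (q * m ≤ (e.1.2 : ℕ) ∧ (e.1.2 : ℕ) < q * m + m)))
    {L : ℕ} (hL : 24 * L + 60 ≤ m) :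
    Tfib ^ L ≤ (complexity (triPM n ^ M * Y) + 1) * (Tfib - 1) ^ L := by
  classical
  have hm : 0 < m := by omega
  obtain ⟨μ, hμ, havoid⟩ := hY
  -- the block substitution (as in `MmBlockFloor.valiant_of_avoids_block`)
  set φ : (Fin n × Fin n) × (Fin n × Fin n) → MvPolynomial ((Fin m × Fin m) × (Fin m × Fin m)) ℝ≥0 :=
    fun e => if (p * m ≤ (e.1.1 : ℕ) ∧ (e.1.1 : ℕ) < p * m + m) ∧ (q * m ≤ (e.1.2 : ℕ) ∧ (e.1.2 : ℕ) < q * m + m) then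
        (if (p * m ≤ (e.2.1 : ℕ) ∧ (e.2.1 : ℕ) < p * m + m) ∧ (q * m ≤ (e.2.2 : ℕ) ∧ (e.2.2 : ℕ) < q * m + m) then
          (MvPolynomial.X ((⟨((e.1.1 : ℕ) - p * m) % m, Nat.mod_lt _ hm⟩, ⟨((e.1.2 : ℕ) - q * m) % m, Nat.mod_lt _ hm⟩),
              (⟨((e.2.1 : ℕ) - p * m) % m, Nat.mod_lt _ hm⟩, ⟨((e.2.2 : ℕ) - q * m) % m, Nat.mod_lt _ hm⟩)) :
            MvPolynomial ((Fin m × Fin m) × (Fin m × Fin m)) ℝ≥0)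
        else 0)
      else 1 with hφ
  have hprojφ : ∀ e, (∃ j, φ e = MvPolynomial.X j) ∨ ∃ c : ℝ≥0, φ e = C c := by
    intro e
    simp only [hφ]
    split_ifs
    · exact Or.inl ⟨_, rfl⟩
    · exact Or.inr ⟨0, by simp⟩
    · exact Or.inr ⟨1, by simp⟩
  have hφ1 : ∀ e : (Fin n × Fin n) × (Fin n × Fin n),
      ¬ ((p * m ≤ (e.1.1 : ℕ) ∧ (e.1.1 : ℕ) < p * m + m) ∧ (q * m ≤ (e.1.2 : ℕ) ∧ (e.1.2 : ℕ) < q * m + m)) →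
      φ e = 1 := by
    intro e he
    simp only [hφ]
    rw [if_neg he]
  obtain ⟨g, hg⟩ := stub_blockComplementCover n m p q hn hme hpm hqm
  obtain ⟨c, hc, heq⟩ := stub_blockRestriction n m p q hm hpm hqm ⟨g, hg⟩
  have heq' : aeval φ (triPM n) = c • triPM m := heq
  -- the substituted cofactor has non-zero constant term
  set Y' := aeval φ Y with hY'
  have hYsum : Y' = ∑ ν ∈ Y.support, C (coeff ν Y) * ν.prod fun i k => φ i ^ k := by
    rw [hY']
    conv_lhs => rw [Y.as_sum]
    rw [map_sum]
    refine Finset.sum_congr rfl fun ν _ => ?_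
    rw [aeval_monomial]
    rfl
  have hμterm : (C (coeff μ Y) * μ.prod fun i k => φ i ^ k) = C (coeff μ Y) := by
    rw [Finsupp.prod, Finset.prod_eq_one, mul_one]
    intro e he
    rw [hφ1 e (havoid e he), one_pow]
  have hle : coeff μ Y ≤ coeff 0 Y' := by
    rw [hYsum, coeff_sum]
    have := Finset.single_le_sum (s := Y.support)
      (f := fun ν => coeff 0 (C (coeff ν Y) * ν.prod fun i k => φ i ^ k))
      (fun _ _ => _root_.zero_le) hμ
    simp only [hμterm, coeff_C, if_true] at this
    exact this
  have hY0' : coeff 0 Y' ≠ 0 := by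
    intro h0
    rw [h0, nonpos_iff_eq_zero] at hle
    exact (mem_support_iff.1 hμ) hle
  have hcM : c ^ M ≠ 0 := pow_ne_zero _ hc
  have hY0 : coeff 0 (c ^ M • Y') ≠ 0 := by
    rw [coeff_smul, smul_eq_mul]
    exact mul_ne_zero hcM hY0'
  -- the substitution is free and lands on `D_m^M · (c^M • Y')`
  have hproj : IsProjection (triPM m ^ M * (c ^ M • Y')) (triPM n ^ M * Y) := by
    refine ⟨φ, hprojφ, ?_⟩
    rw [map_mul, map_pow, heq', hY', smul_pow, smul_mul_assoc, mul_smul_comm]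
  have hcx : complexity (triPM m ^ M * (c ^ M • Y')) ≤ complexity (triPM n ^ M * Y) :=
    complexity_le_of_isProjection hproj
  -- `D_m^M` is homogeneous, so the unit cofactor costs at most one gate
  have hhom : (triPM m ^ M).IsHomogeneous (Fintype.card (Fin m × Fin m) * M) :=
    (isFullyOrdered_triPM m).isHomogeneous.pow M
  have hunit := complexity_le_of_mul_unit hhom hY0
  -- D-II for `D_m^M`
  have hpow := triPM_pow_lower_bound m M hme h64 hM L hL
  calc Tfib ^ L ≤ complexity (triPM m ^ M) * (Tfib - 1) ^ L := hpow
    _ ≤ (complexity (triPM n ^ M * Y) + 1) * (Tfib - 1) ^ L := Nat.mul_le_mul_right _ (by omega)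

/-- Exponent bookkeeping with one unit of slack: `(2j + 1 + c)^c + 1 ≤ (j + (2c+1))^(2c+1)` for `j ≥ 1`.
[folklore] -/
theorem pow_succ_le_pow_aux {j : ℕ} (hj : 1 ≤ j) (c : ℕ) :
    (2 * j + 1 + c) ^ c + 1 ≤ (j + (2 * c + 1)) ^ (2 * c + 1) := by
  have h1 : 2 * j + 1 + c ≤ (j + c + 1) ^ 2 := by nlinarith
  have h2 : (2 * j + 1 + c) ^ c ≤ (j + (2 * c + 1)) ^ (2 * c) :=
    calc (2 * j + 1 + c) ^ c ≤ ((j + c + 1) ^ 2) ^ c := Nat.pow_le_pow_left h1 c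
      _ = (j + c + 1) ^ (2 * c) := by rw [← pow_mul]
      _ ≤ (j + (2 * c + 1)) ^ (2 * c) := Nat.pow_le_pow_left (by omega) _
  have h3 : 1 ≤ (j + (2 * c + 1)) ^ (2 * c) := Nat.one_le_pow _ _ (by omega)
  calc (2 * j + 1 + c) ^ c + 1 ≤ (j + (2 * c + 1)) ^ (2 * c) + (j + (2 * c + 1)) ^ (2 * c) :=
        Nat.add_le_add h2 h3
    _ = (j + (2 * c + 1)) ^ (2 * c) * 2 := by ring
    _ ≤ (j + (2 * c + 1)) ^ (2 * c) * (j + (2 * c + 1)) := Nat.mul_le_mul_left _ (by omega)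
    _ = (j + (2 * c + 1)) ^ (2 * c + 1) := by rw [pow_succ]

/-- Every monomial of `D_n^(M+1) · Y` (`Y ≠ 0`, `n` even) carries a whole dimer monomial, so
`n² ≤ 2 L₊(D_n^(M+1) · Y) + 1`. [folklore] -/
theorem sq_le_complexity_pow_mul (hn : Even n) (M : ℕ) {Y : MvPolynomial ((Fin n × Fin n) × (Fin n × Fin n)) ℝ≥0}
    (hY : Y ≠ 0) : n * n ≤ 2 * complexity (triPM n ^ (M + 1) * Y) + 1 := by
  classical
  obtain ⟨f₀, hf₀⟩ := dimers_nonempty hn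
  obtain ⟨μ, hμ⟩ := support_nonempty.2 hY
  have hD : (M + 1) • dimerExp f₀ ∈ (triPM n ^ (M + 1)).support :=
    TriPMPow.smul_dimerExp_mem_support_pow (M + 1) hf₀
  have hmem : (M + 1) • dimerExp f₀ + μ ∈ (triPM n ^ (M + 1) * Y).support :=
    Literature.Computability.AlgebraicComplexity.add_mem_support_mul hD hμ
  have hsub : (Finset.univ.image fun v : Fin n × Fin n => (v, f₀ v)) ⊆ (triPM n ^ (M + 1) * Y).vars := by
    intro e he
    obtain ⟨v, -, rfl⟩ := Finset.mem_image.1 he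
    rw [mem_vars_iff_mem_support]
    refine ⟨(M + 1) • dimerExp f₀ + μ, hmem, ?_⟩
    rw [Finsupp.mem_support_iff, Finsupp.add_apply, Finsupp.smul_apply, dimerExp_apply]
    simp
  have hcard : (Finset.univ.image fun v : Fin n × Fin n => (v, f₀ v)).card = n * n := by
    rw [Finset.card_image_of_injective _ (fun v w h => (Prod.ext_iff.1 h).1), Finset.card_univ,
      Fintype.card_prod, Fintype.card_fin]
  calc n * n = (Finset.univ.image fun v : Fin n × Fin n => (v, f₀ v)).card := hcard.symm
    _ ≤ (triPM n ^ (M + 1) * Y).vars.card := Finset.card_le_card hsub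
    _ ≤ 2 * complexity (triPM n ^ (M + 1) * Y) + 1 :=
        Summit.ValiantsHypothesis.Theorems.PerDivisionHardNegative.card_vars_le_complexity _

end TriPMPowMul

open TriPMPowMul

/-- **`D_n^M · Y` with `Y` sparse somewhere is exponentially hard (Part D-III).**  For even `n`, even
`m ≥ 64`, `M ≥ 1`, `24 L + 60 ≤ m`, and any `Y` having a monomial that meets fewer than `(n/m)²` first
vertices: `T^L ≤ (L₊(D_n^M · Y) + 1) · (T-1)^L` (`T = 6^44`).  Unifies D-I (`M = 1`) and D-II (`Y = 1`).
[cite: Valiant1980, §3 Thm 1] -/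
theorem triPM_pow_mul_blockFloor :
    ∀ (n m M : ℕ), Even n → 64 ≤ m → Even m → 1 ≤ M →
      ∀ (Y : MvPolynomial ((Fin n × Fin n) × (Fin n × Fin n)) ℝ≥0),
        (∃ μ ∈ Y.support, (μ.support.image fun e => e.1).card < (n / m) * (n / m)) →
        ∀ (L : ℕ), 24 * L + 60 ≤ m →
          Tfib ^ L ≤ (complexity (triPM n ^ M * Y) + 1) * (Tfib - 1) ^ L := by
  classical
  intro n m M hn h64 hme hM Y hY L hL
  obtain ⟨μ, hμ, hcard⟩ := hY
  obtain ⟨p, q, hp, hq, havoid⟩ := MmBlockFloor.exists_block_avoiding (μ.support.image fun e => e.1) hcard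
  have hk : (n / m) * m ≤ n := Nat.div_mul_le_self n m
  have hpm : p * m + m ≤ n := by nlinarith
  have hqm : q * m + m ≤ n := by nlinarith
  refine pow_mul_of_avoids_block hn h64 hme hM hpm hqm Y ⟨μ, hμ, fun e he => ?_⟩ hL
  exact havoid e.1 (Finset.mem_image_of_mem _ he)

/-- **No `X = D_n^M · Y` with `Y` sparse somewhere is an uncharged certificate for `D_n`.**  No constant
`c` admits, for every `n`, an exponent `M` and a `Y` having a monomial with fewer than
`n² / 2^((log₂ n + c)^c)` variables such that `L₊(D_n^(M+1) · Y) ≤ 2^((log₂ n + c)^c)`.  Contains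
`not_mm_certificate_with_sparse_monomial` (`M = 0`) and `not_mm_certificate_pow` (`Y = 1`).
[cite: Valiant1980, §3 Thm 1] -/
theorem not_mm_certificate_pow_mul_sparse :
    ¬ ∃ c : ℕ, ∀ n : ℕ, ∃ (M : ℕ) (Y : MvPolynomial ((Fin n × Fin n) × (Fin n × Fin n)) ℝ≥0),
      (∃ μ ∈ Y.support, μ.support.card * bound c n < n * n) ∧
      complexity (triPM n ^ (M + 1) * Y) ≤ bound c n := by
  classical
  rintro ⟨c, H⟩
  obtain ⟨j, hj6, hviol⟩ := exists_m_violating (2 * c + 1)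
  obtain ⟨M, Y, ⟨μ, hμ, hsparse⟩, hle⟩ := H (2 ^ (2 * j + 1))
  have hlog : Nat.log 2 (2 ^ (2 * j + 1)) = 2 * j + 1 := Nat.log_pow (by norm_num) _
  have hn : Even (2 ^ (2 * j + 1)) := Nat.even_pow.2 ⟨even_two, by omega⟩
  rcases Nat.eq_zero_or_pos c with rfl | hc
  · -- `c = 0`: the bound is `2`, but the product has `n²` variables
    have hb : bound 0 (2 ^ (2 * j + 1)) = 2 := by unfold bound; simp
    rw [hb] at hle
    have hY0 : Y ≠ 0 := ne_zero_iff.2 ⟨μ, mem_support_iff.1 hμ⟩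
    have hsq := sq_le_complexity_pow_mul hn M hY0
    have h8 : 8 ≤ 2 ^ (2 * j + 1) := by
      calc 8 = 2 ^ 3 := by norm_num
        _ ≤ 2 ^ (2 * j + 1) := Nat.pow_le_pow_right (by norm_num) (by omega)
    nlinarith
  · -- `c ≥ 1`: the sparse monomial meets fewer than `2n = (n / 2^j)²` first vertices
    have hme : Even (2 ^ j) := Nat.even_pow.2 ⟨even_two, by omega⟩
    have h64 : 64 ≤ 2 ^ j := by
      calc 64 = 2 ^ 6 := by norm_num
        _ ≤ 2 ^ j := Nat.pow_le_pow_right (by norm_num) hj6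
    have hdiv : 2 ^ (2 * j + 1) / 2 ^ j = 2 ^ (j + 1) := by
      rw [Nat.pow_div (by omega) (by norm_num)]
      congr 1
      omega
    have hfew : (μ.support.image fun e => e.1).card < (2 ^ (2 * j + 1) / 2 ^ j) * (2 ^ (2 * j + 1) / 2 ^ j) := by
      rw [hdiv]
      have h1 : (μ.support.image fun e => e.1).card ≤ μ.support.card := Finset.card_image_le
      have hbound : 2 ^ (2 * j + 1 + 1) ≤ bound c (2 ^ (2 * j + 1)) := by
        unfold bound; rw [hlog]
        refine Nat.pow_le_pow_right (by norm_num) ?_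
        calc 2 * j + 1 + 1 ≤ 2 * j + 1 + c := by omega
          _ ≤ (2 * j + 1 + c) ^ c := Nat.le_self_pow (by omega) _
      have h2 : μ.support.card * 2 ^ (2 * j + 1 + 1) < 2 ^ (2 * j + 1) * 2 ^ (2 * j + 1) :=
        lt_of_le_of_lt (Nat.mul_le_mul_left _ hbound) hsparse
      have e1 : 2 ^ (2 * j + 1) * 2 ^ (2 * j + 1) = 2 ^ (2 * j) * 2 ^ (2 * j + 1 + 1) := by
        rw [← pow_add, ← pow_add]; congr 1; omega
      rw [e1] at h2
      have h4 : μ.support.card < 2 ^ (2 * j) := Nat.lt_of_mul_lt_mul_right h2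
      have h5 : 2 ^ (2 * j) ≤ 2 ^ (j + 1) * 2 ^ (j + 1) := by
        rw [← pow_add]; exact Nat.pow_le_pow_right (by norm_num) (by omega)
      omega
    have hlb : ∀ L, 24 * L + 60 ≤ 2 ^ j →
        Tfib ^ L ≤ 4 * (complexity (triPM (2 ^ (2 * j + 1)) ^ (M + 1) * Y) + 1) *
          (2 ^ j * 2 ^ j + 1) ^ 2 * (Tfib - 1) ^ L := by
      intro L hL
      have h1 := triPM_pow_mul_blockFloor _ _ (M + 1) hn h64 hme (by omega) Y ⟨μ, hμ, hfew⟩ L hL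
      refine h1.trans (Nat.mul_le_mul_right _ ?_)
      have h2 : 1 ≤ (2 ^ j * 2 ^ j + 1) ^ 2 := Nat.one_le_pow _ _ (by omega)
      calc complexity (triPM (2 ^ (2 * j + 1)) ^ (M + 1) * Y) + 1
          = 1 * (complexity (triPM (2 ^ (2 * j + 1)) ^ (M + 1) * Y) + 1) * 1 := by ring
        _ ≤ 4 * (complexity (triPM (2 ^ (2 * j + 1)) ^ (M + 1) * Y) + 1) * (2 ^ j * 2 ^ j + 1) ^ 2 :=
          Nat.mul_le_mul (Nat.mul_le_mul_right _ (by norm_num)) h2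
    have hF : complexity (triPM (2 ^ (2 * j + 1)) ^ (M + 1) * Y) + 1 ≤ 2 ^ ((j + (2 * c + 1)) ^ (2 * c + 1)) := by
      have h1 : complexity (triPM (2 ^ (2 * j + 1)) ^ (M + 1) * Y) + 1 ≤ 2 ^ ((2 * j + 1 + c) ^ c) + 1 := by
        unfold bound at hle; rw [hlog] at hle; omega
      refine h1.trans ?_
      calc 2 ^ ((2 * j + 1 + c) ^ c) + 1 ≤ 2 ^ ((2 * j + 1 + c) ^ c) + 2 ^ ((2 * j + 1 + c) ^ c) :=
            Nat.add_le_add_left Nat.one_le_two_pow _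
        _ = 2 ^ ((2 * j + 1 + c) ^ c + 1) := by rw [pow_succ]; ring
        _ ≤ 2 ^ ((j + (2 * c + 1)) ^ (2 * c + 1)) :=
            Nat.pow_le_pow_right (by norm_num) (pow_succ_le_pow_aux (by omega) c)
    have hkey := key_ineq_of_bound hj6 hlb hF
    exact absurd (hkey.trans_lt hviol) (lt_irrefl _)

end Summit.ValiantsHypothesis.ValiantsHypothesis.Theorems.DivisionGapZeroOneTransfer

end
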